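import Literature.IUT.HodgeTheaters.GoodLocalFrobenioidOfKit
import Literature.IUT.HodgeTheaters.GaloisValDatumOfComplete
import HarnessLib

/-!
# [IUTchI] Example 3.3 over REAL bases: `D_v = 𝓑(Π_v)⁰ ⊇ D⊢_v = 𝓑(G_v)⁰`, `Spec L ↦ L` (MERGE L5 × L1 × L3/L4)

Mochizuki, *Inter-universal Teichmüller Theory I*, kurims manuscript (May 2020), Ex. 3.3 (i)–(ii) pp. 77–79
[cite: Mochizuki2012, I Ex 3.3 pp.77-79] (D-0012 claim key, status disputed; nothing of the series is asserted — this
file CONSTRUCTS an inhabitant of abc-iut-L5-t2's frozen interface `GoodLocalFrobenioid p K_v` (`SplitFrobenioids.lean`)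
in which, besides the Frobenioid side (`GoodLocalFrobenioid.ofKit` over abc-iut-L1-t4's [FrdII] Ex. 1.1 kit), ALSO
THE BASE is real:
* `D⊢_v := 𝓑(K_v)⁰` is the small coset category `CosetCat Gal(Ω/k)` of the absolute Galois group of `k = K_v`
  (Krull topology; `Ω = K̄_v`), and `D_v := 𝓑(X̲→_v)⁰ = 𝓑(Π_v)⁰` the coset category `CosetCat Π_v` of a topological
  group `Π_v` (print: the arithmetic fundamental group of `X̲→_v`, [IUTchI] Def. 3.1 (e)(f) — an INPUT here, with its
  augmentation `aug : Π_v ↠ G_v`, continuous, open, surjective: the exact sequence `1 → Δ → Π_v → G_v → 1`);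
* `D⊢_v ⊆ D_v` is the pull-back `CosetCat.pull aug` ("by pulling back finite étale coverings via the structure
  morphism `X̲→_v → Spec(K_v)`"; FULL, FAITHFUL), `D_v → D⊢_v` is `CosetCat.push aug` and the printed "left-adjoint to
  the natural inclusion functor" is `CosetCat.pushPullAdj` (`CosetCategories.lean`);
* `Spec L ↦ L` is `GaloisValDatum.fieldFunctor` (`GaloisCosetFields.lean`): `G_v/U ↦ Ω^U` with its valuation, every
  `Ω^U` a `p_v`-adic local field (`fieldFunctor_isPadicLocal`);
* `Φ_{C_v} := ord(𝒪^▷)^pf`, `Φ_{C⊢_v} := ℕ·ord(p_v)`, `C_v ⊇ C⊢_v`, `τ⊢_v` are abc-iut-L1-t4's [FrdII] kit objects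
  (`PadicFrd.GoodLocalKit`, through `ofKit`).
INPUTS that remain (honest, named): the valued Galois closure `GaloisValDatum` of `K_v` (uniqueness of the extension of
the valuation as the two hypotheses `valExt`, `val_aut`) and the group `Π_v ↠ G_v`; the identification of `Π_v` with
the `π₁` interface of [IUTchI] Def. 3.1 at `v ∈ V̲^good ∩ V̲^non` (decomposition group `G_v ⊆ G_K`, abc-iut-L4-t1's
`FundamentalExtension`) is the Def. 3.1-level instantiation, not done here. MODELLING CHOICES as in
`GoodLocalFrobenioidOfKit.lean` (`C^Θ_v := C⊢_v` with the relabelled generator).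
-/

namespace Literature.IUT.HodgeTheaters

open CategoryTheory Literature.AnabelianGeometry.SemiGraphs Literature.AlgebraicGeometry.Frobenioids
open Literature.AlgebraicGeometry.Frobenioids.PadicFrd

universe u

namespace GoodLocalFrobenioid

variable {p : ℕ} [Fact p.Prime] (d : GaloisValDatum.{u} p) {P : Type u} [Group P] [TopologicalSpace P]
  (aug : P →* d.Gal) (hc : Continuous aug) (hs : Function.Surjective aug) (ho : IsOpenMap aug)
  (Kv : Type) [Field Kv] [ValuativeRel Kv] (hp : ((p : Kv)) ∈ PadicFrd.intNonzero Kv)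

/-- The field functor on `D_v = CosetCat Π_v`: `Π_v/U ↦ Ω^{aug(U)}` ("by pull-back via the natural functor
`D_v → D⊢_v`"). [claim: Mochizuki2012, status: disputed] -/
noncomputable abbrev galoisBaseV : CosetCat P ⥤ PadicFld.{u} p := CosetCat.push aug ho ⋙ d.fieldFunctor

/-- Its objects are `p_v`-adic local fields. [claim: Mochizuki2012, status: disputed] -/
theorem galoisBaseV_isPadicLocal (A : CosetCat P) : ((galoisBaseV d aug ho).obj A).IsPadicLocal :=
  hlocOver (CosetCat.push aug ho) d.fieldFunctor d.fieldFunctor_isPadicLocal A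

/-- **[IUTchI] Example 3.3 (i)–(ii) over the REAL bases `𝓑(Π_v)⁰ ⊇ 𝓑(G_v)⁰`** (small coset models) with the field
functor `Spec L ↦ L` of the valued Galois closure `Ω/k` of `k = K_v` and abc-iut-L1-t4's [FrdII] kit
(`Φ_{C_v} = ord(𝒪^▷)^pf`, `Φ_{C⊢_v} = ℕ·ord(p_v)`): an inhabitant of `GoodLocalFrobenioid p K_v` all of whose
categorical and Frobenioid-theoretic fields are constructed (inputs: `GaloisValDatum`, `aug : Π_v ↠ G_v` continuous open
surjective, and the Type-0 carrier `K_v ∋ p_v` of the interface). [claim: Mochizuki2012, status: disputed] -/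
noncomputable def ofGalois : GoodLocalFrobenioid.{u} p Kv :=
  haveI := CosetCat.pull_full aug hc hs
  haveI := CosetCat.pull_faithful aug hc hs
  ofKit (CosetCat.pull aug hc hs) (CosetCat.push aug ho) (CosetCat.pushPullAdj aug hc hs ho) d.fieldFunctor
    d.fieldFunctor_isPadicLocal CosetCat.isConnected CosetCat.isTotallyEpimorphic CosetCat.isConnected
    CosetCat.isTotallyEpimorphic Kv hp

/-- `D_v` of `ofGalois` IS the coset category of `Π_v` and `D⊢_v` that of `G_v = Gal(Ω/k)`.
[claim: Mochizuki2012, status: disputed] -/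
theorem ofGalois_bases :
    (ofGalois d aug hc hs ho Kv hp).Dv = CosetCat P ∧ (ofGalois d aug hc hs ho Kv hp).Ddash = CosetCat d.Gal :=
  ⟨rfl, rfl⟩

/-- `D⊢_v ⊆ D_v` of `ofGalois` IS the pull-back along `aug`, and `D_v → D⊢_v` the push-forward.
[claim: Mochizuki2012, status: disputed] -/
theorem ofGalois_incl_proj :
    (ofGalois d aug hc hs ho Kv hp).incl = CosetCat.pull aug hc hs ∧
      (ofGalois d aug hc hs ho Kv hp).proj = CosetCat.push aug ho :=
  ⟨rfl, rfl⟩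

/-- The divisor monoid of `C_v` of `ofGalois` on `D⊢_v` is `Spec L ↦ ord(𝒪^▷_L)^pf` for the fields `L = Ω^U`
(print: "`Φ_{C_v} : Spec(L) ↦ ord(𝒪^▷_L)^pf`"). [claim: Mochizuki2012, status: disputed] -/
theorem ofGalois_PhiC :
    (ofGalois d aug hc hs ho Kv hp).PhiC =
      (Datum.perf d.fieldFunctor d.fieldFunctor_isPadicLocal CosetCat.isConnected CosetCat.isTotallyEpimorphic).Φ :=
  rfl

/-- **Unconditional witness at `K_v = ℚ_p` with `Π_v := G_v`** (no covering: `Δ = 1`): Ex. 3.3 over the REAL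
absolute Galois group `Gal(ℚ̄_p/ℚ_p)` (Krull topology), `D_v = D⊢_v = CosetCat Gal(ℚ̄_p/ℚ_p)`, field functor
`U ↦ ℚ̄_p^U` with the spectral norm, [FrdII] Frobenioids of abc-iut-L1-t4 — EVERY input discharged
(`GaloisValDatum.ofPadic`). [claim: Mochizuki2012, status: disputed] -/
noncomputable def ofPadicGalois (p : ℕ) [Fact p.Prime] : GoodLocalFrobenioid.{0} p ℚ_[p] :=
  ofGalois (GaloisValDatum.ofPadic p) (MonoidHom.id _) continuous_id Function.surjective_id IsOpenMap.id ℚ_[p]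
    (PadicFrd.p_mem_intNonzero p)

/-- **Unconditional witness at an ACTUAL place: `K_v := F_v`**, the completion of a number field `F` at a finite place
`v ∣ p` (abc-iut-S7's `RescaledCompletion`, normed by `‖·‖_v^{1/n_v}`), `Ω := F̄_v` with the spectral norm
(`GaloisValDatum.ofPlace`), `Π_v := G_v` (no covering), `D_v = D⊢_v = CosetCat Gal(F̄_v/F_v)`, [FrdII] Frobenioids of
abc-iut-L1-t4 — every input discharged except the curve (`Π_v = G_v` stands for `X̲→_v := Spec F_v`, a labelled
degenerate choice). [claim: Mochizuki2012, status: disputed] -/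
noncomputable def ofPlaceGalois (F : Type) [Field F] [NumberField F] (p : ℕ) [Fact p.Prime]
    (v : IsDedekindDomain.HeightOneSpectrum (NumberField.RingOfIntegers F)) (hv : ((p : ℕ) : NumberField.RingOfIntegers F) ∈ v.asIdeal) :
    @GoodLocalFrobenioid.{0} p (Literature.NumberTheory.NumberFields.RescaledCompletion F p v hv) _
      (GaloisValDatum.normVal (Literature.NumberTheory.NumberFields.RescaledCompletion F p v hv)) :=
  @ofGalois p _ (GaloisValDatum.ofPlace F p v hv) _ _ _ (MonoidHom.id _) continuous_id Function.surjective_id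
    IsOpenMap.id (Literature.NumberTheory.NumberFields.RescaledCompletion F p v hv) _
    (GaloisValDatum.normVal _) (GaloisValDatum.p_mem_normVal p _)

end GoodLocalFrobenioid

end Literature.IUT.HodgeTheaters
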